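import Mathlib
import Summits.NavierStokesRegularity.NavierStokesRegularity.Theorems.WakeRatchetTailRatchetRelayContraction
import HarnessLib

/-!
# `WakeRatchet.TailRatchet` (stmt-NavierStokesRegularity-21808): the PICARD SEQUENCE of the lacunary front
# construction — iteration in the weighted ball with geometric decay of differences

Support file for the crux `TailRatchet` (route `WakeRatchet`; MODEL lattice ODEs of Tao 2016 §1.2, §4 —
nothing in this file is a statement about the Navier–Stokes equations, and no item is closed here).

Context (programme "R-lac" of the census of stmt-21808, ASSEMBLY, step 2/3): iterating the Picard step of
`…RelayContraction` from `(h, h', δ) = (0, 0, 0)` at a fixed time ratio `s ∈ [2 − 10⁻²⁶, 2]`, `η = 2 − s`,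
radius `r = 8Kη` (`K = 1100000`):

* `picard_sequence` — there are sequences `h_n, h_n' : ℝ → ℝ`, `δ_n : ℝ` (`n ∈ ℕ`), all in the weighted ball
  of radius `r`, `h_0 = 0`, `δ_0 = 0`, each `(h_{n+1}, δ_{n+1})` the drain-bordered solution with forcing
  `N_s(h_n, δ_n)` (`h_{n+1}' = 2e^{t/2}h_{n+1}(t/2) + N_s(h_n,δ_n) − δ_{n+1}·8e^{3t}`), and consecutive terms at
  weighted distance `≤ r κⁿ` with `κ = K(22η + 36r + 32r²) ≤ 1/2`.

The limit (the lacunary front) is extracted in the companion file `…RelayFront`.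

HONEST FRAMING: bookkeeping over the tree's linear theory; MODEL lattice only; lacunary fronts (LARGE `ε₀`)
do NOT refute `TailRatchet` (which needs `Λ → 1`); the construction item and the crux stay open.
-/

noncomputable section

set_option linter.dupNamespace false

namespace Summit.NavierStokesRegularity.NavierStokesRegularity.Theorems

namespace WakeRatchetRelayFixedPoint

open Set Filter Topology MeasureTheory
open WakeRatchetRelayNonlinearMap WakeRatchetRelayInverseBound WakeRatchetRelayContraction

/-! ## Numerical bookkeeping at radius `r = 8Kη`, `η ≤ 10⁻²⁶` -/

/-- Self-map inequality: `K·A(8Kη) ≤ 8Kη` for `0 ≤ η ≤ 10⁻²⁶`. [folklore] -/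
theorem selfmap_ineq {η : ℝ} (h0 : 0 ≤ η) (h1 : η ≤ 1 / 10 ^ 26) :
    1100000 * (4 * η + 22 * η * (8800000 * η) + 20 * (8800000 * η) ^ 2 + 16 * (8800000 * η) ^ 3) ≤
      8800000 * η := by
  have h2 : η ^ 2 ≤ η * (1 / 10 ^ 26) := by nlinarith
  have h3 : η ^ 3 ≤ η * (1 / 10 ^ 26) := by nlinarith
  nlinarith

/-- Contraction inequality: `κ = K(22η + 36r + 32r²) ≤ 1/2` at `r = 8Kη`, `0 ≤ η ≤ 10⁻²⁶`. [folklore] -/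
theorem contraction_ineq {η : ℝ} (h0 : 0 ≤ η) (h1 : η ≤ 1 / 10 ^ 26) :
    1100000 * (22 * η + 36 * (8800000 * η) + 32 * (8800000 * η) ^ 2) ≤ 1 / 2 := by
  have h2 : η ^ 2 ≤ η * (1 / 10 ^ 26) := by nlinarith
  nlinarith

/-- Second-order smallness: `2rκ ≤ 10²²η²` at `r = 8Kη`, `0 ≤ η ≤ 10⁻²⁶`. [folklore] -/
theorem second_order_ineq {η : ℝ} (h1 : η ≤ 1 / 10 ^ 26) :
    2 * (8800000 * η) * (1100000 * (22 * η + 36 * (8800000 * η) + 32 * (8800000 * η) ^ 2)) ≤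
      10 ^ 22 * η ^ 2 := by
  have h3 : η ^ 3 ≤ η ^ 2 * (1 / 10 ^ 26) := by nlinarith
  nlinarith [sq_nonneg η]

/-! ## The Picard sequence -/

/-- **THE PICARD SEQUENCE.**  At `s ∈ [2 − 10⁻²⁶, 2]`, `η = 2 − s`, `r = 8Kη`, `κ = K(22η + 36r + 32r²)`:
sequences `h_n, h_n', δ_n` in the weighted ball of radius `r`, starting from `0`, each term the drain-bordered
image of the previous one under the forcing `N_s`, with consecutive weighted distances `≤ rκⁿ`.
[cite: Tao2016AveragedNS, §1.2 (dyadic model); cell vocabulary (programme R-lac of the census of stmt-21808, assembly)] -/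
theorem picard_sequence {s : ℝ} (hs1 : 2 - 1 / 10 ^ 26 ≤ s) (hs2 : s ≤ 2) :
    ∃ (hs hs' : ℕ → ℝ → ℝ) (ds : ℕ → ℝ),
      (∀ n, Continuous (hs n)) ∧ (∀ n, hs n 0 = 0) ∧ (∀ n, Tendsto (hs n) atBot (𝓝 0)) ∧
      (∀ n (t : ℝ), t < 0 → HasDerivAt (hs n) (hs' n t) t) ∧
      (∀ n (t : ℝ), t ≤ 0 → |hs n t| ≤ 8800000 * (2 - s) * Real.exp (t / 2)) ∧
      (∀ n (t : ℝ), t < 0 → |hs' n t| ≤ 8800000 * (2 - s) * Real.exp (t / 2)) ∧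
      (∀ n, |ds n| ≤ 8800000 * (2 - s)) ∧
      (∀ t, hs 0 t = 0) ∧ ds 0 = 0 ∧
      (∀ n (t : ℝ), hs' (n + 1) t =
        2 * Real.exp (t / 2) * hs (n + 1) (t / 2) +
          (((-(Real.exp t - 4 / s ^ 2 * Real.exp (2 * t / s)) -
              (2 * Real.exp (t / 2) * hs n (t / 2) - 8 / s ^ 2 * Real.exp (t / s) * hs n (t / s)) +
              4 / s ^ 2 * hs n (t / s) ^ 2 -
              ds n * (4 * s * ((Real.exp t + hs n t) * (Real.exp (s * t) + hs n (s * t))) -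
                8 * Real.exp (3 * t))))
            - ds (n + 1) * (8 * Real.exp (3 * t)))) ∧
      (∀ n (t : ℝ), t ≤ 0 → |hs (n + 1) t - hs n t| ≤ 8800000 * (2 - s) *
        (1100000 * (22 * (2 - s) + 36 * (8800000 * (2 - s)) + 32 * (8800000 * (2 - s)) ^ 2)) ^ n *
          Real.exp (t / 2)) ∧
      (∀ n (t : ℝ), t < 0 → |hs' (n + 1) t - hs' n t| ≤ 8800000 * (2 - s) *
        (1100000 * (22 * (2 - s) + 36 * (8800000 * (2 - s)) + 32 * (8800000 * (2 - s)) ^ 2)) ^ n *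
          Real.exp (t / 2)) ∧
      (∀ n, |ds (n + 1) - ds n| ≤ 8800000 * (2 - s) *
        (1100000 * (22 * (2 - s) + 36 * (8800000 * (2 - s)) + 32 * (8800000 * (2 - s)) ^ 2)) ^ n) := by
  -- constants
  set η : ℝ := 2 - s with hη
  have hη0 : 0 ≤ η := by rw [hη]; linarith
  have hη1 : η ≤ 1 / 10 ^ 26 := by rw [hη]; linarith
  have hs32 : (3 : ℝ) / 2 ≤ s := by
    have : (1 : ℝ) / 10 ^ 26 ≤ 1 / 2 := by norm_num
    linarith
  have habs : |s - 2| = η := by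
    rw [hη, abs_sub_comm]; exact abs_of_nonneg (by linarith)
  set r : ℝ := 8800000 * η with hr
  have hr0 : 0 ≤ r := by rw [hr]; positivity
  set κ : ℝ := 1100000 * (22 * η + 36 * r + 32 * r ^ 2) with hκ
  have hκ0 : 0 ≤ κ := by rw [hκ]; positivity
  have hself : 1100000 * (4 * |s - 2| + 22 * |s - 2| * r + 20 * r ^ 2 + 16 * r ^ 3) ≤ r := by
    rw [habs, hr]; exact selfmap_ineq hη0 hη1
  have hcontr : 1100000 * (22 * |s - 2| + 36 * r + 32 * r ^ 2) = κ := by rw [habs]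
  -- the state space and the ball
  let P : (ℝ → ℝ) × (ℝ → ℝ) × ℝ → Prop := fun x =>
    Continuous x.1 ∧ x.1 0 = 0 ∧ Tendsto x.1 atBot (𝓝 0) ∧
    (∀ t : ℝ, t < 0 → HasDerivAt x.1 (x.2.1 t) t) ∧
    (∀ t : ℝ, t ≤ 0 → |x.1 t| ≤ r * Real.exp (t / 2)) ∧
    (∀ t : ℝ, t < 0 → |x.2.1 t| ≤ r * Real.exp (t / 2)) ∧ |x.2.2| ≤ r
  -- one step inside the ball
  have hstep : ∀ x : (ℝ → ℝ) × (ℝ → ℝ) × ℝ, P x → ∃ y : (ℝ → ℝ) × (ℝ → ℝ) × ℝ, P y ∧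
      ∀ t : ℝ, y.2.1 t = 2 * Real.exp (t / 2) * y.1 (t / 2) +
          (((-(Real.exp t - 4 / s ^ 2 * Real.exp (2 * t / s)) -
              (2 * Real.exp (t / 2) * x.1 (t / 2) - 8 / s ^ 2 * Real.exp (t / s) * x.1 (t / s)) +
              4 / s ^ 2 * x.1 (t / s) ^ 2 -
              x.2.2 * (4 * s * ((Real.exp t + x.1 t) * (Real.exp (s * t) + x.1 (s * t))) -
                8 * Real.exp (3 * t))))
            - y.2.2 * (8 * Real.exp (3 * t))) := by
    rintro ⟨h, h', δ⟩ ⟨hc, -, -, hd, hρ, hD, hδ⟩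
    obtain ⟨ε, g, hgc, hg0, hgl, hgd, hε, hgb, hgb'⟩ := picard_step hs32 hs2 hc hd hρ hD hδ
    refine ⟨⟨g, fun t => 2 * Real.exp (t / 2) * g (t / 2) +
          (((-(Real.exp t - 4 / s ^ 2 * Real.exp (2 * t / s)) -
              (2 * Real.exp (t / 2) * h (t / 2) - 8 / s ^ 2 * Real.exp (t / s) * h (t / s)) +
              4 / s ^ 2 * h (t / s) ^ 2 -
              δ * (4 * s * ((Real.exp t + h t) * (Real.exp (s * t) + h (s * t))) -
                8 * Real.exp (3 * t))))
            - ε * (8 * Real.exp (3 * t))), ε⟩, ⟨hgc, hg0, hgl, hgd, ?_, ?_, hε.trans hself⟩, fun t => rfl⟩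
    · intro t ht
      exact (hgb t ht).trans (mul_le_mul_of_nonneg_right hself (Real.exp_pos _).le)
    · intro t ht
      exact (hgb' t ht.le).trans (mul_le_mul_of_nonneg_right hself (Real.exp_pos _).le)
  choose! T hT using hstep
  -- the iteration
  set x₀ : (ℝ → ℝ) × (ℝ → ℝ) × ℝ := (fun _ => 0, fun _ => 0, 0) with hx₀
  have hP₀ : P x₀ := by
    refine ⟨continuous_const, rfl, tendsto_const_nhds, fun t _ => hasDerivAt_const t (0 : ℝ), ?_, ?_, ?_⟩
    · intro t _; show |(0 : ℝ)| ≤ _; rw [abs_zero]; positivity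
    · intro t _; show |(0 : ℝ)| ≤ _; rw [abs_zero]; positivity
    · show |(0 : ℝ)| ≤ _; rw [abs_zero]; exact hr0
  set xs : ℕ → (ℝ → ℝ) × (ℝ → ℝ) × ℝ := fun n => T^[n] x₀ with hxs
  have hxs0 : xs 0 = x₀ := rfl
  have hxs_succ : ∀ n, xs (n + 1) = T (xs n) := fun n => by
    simp only [hxs]; exact Function.iterate_succ_apply' T n x₀
  have hPn : ∀ n, P (xs n) := by
    intro n
    induction n with
    | zero => exact hP₀
    | succ n ih => rw [hxs_succ]; exact (hT _ ih).1
  have hRel : ∀ n (t : ℝ), (xs (n + 1)).2.1 t = 2 * Real.exp (t / 2) * (xs (n + 1)).1 (t / 2) +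
      (((-(Real.exp t - 4 / s ^ 2 * Real.exp (2 * t / s)) -
          (2 * Real.exp (t / 2) * (xs n).1 (t / 2) - 8 / s ^ 2 * Real.exp (t / s) * (xs n).1 (t / s)) +
          4 / s ^ 2 * (xs n).1 (t / s) ^ 2 -
          (xs n).2.2 * (4 * s * ((Real.exp t + (xs n).1 t) * (Real.exp (s * t) + (xs n).1 (s * t))) -
            8 * Real.exp (3 * t))))
        - (xs (n + 1)).2.2 * (8 * Real.exp (3 * t))) := by
    intro n t
    rw [hxs_succ]
    exact (hT _ (hPn n)).2 t
  -- the bordered law of each image, in explicit form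
  have hLaw : ∀ n (t : ℝ), t < 0 → HasDerivAt (xs (n + 1)).1
      (2 * Real.exp (t / 2) * (xs (n + 1)).1 (t / 2) +
        (((-(Real.exp t - 4 / s ^ 2 * Real.exp (2 * t / s)) -
            (2 * Real.exp (t / 2) * (xs n).1 (t / 2) - 8 / s ^ 2 * Real.exp (t / s) * (xs n).1 (t / s)) +
            4 / s ^ 2 * (xs n).1 (t / s) ^ 2 -
            (xs n).2.2 * (4 * s * ((Real.exp t + (xs n).1 t) * (Real.exp (s * t) + (xs n).1 (s * t))) -
              8 * Real.exp (3 * t))))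
          - (xs (n + 1)).2.2 * (8 * Real.exp (3 * t)))) t := by
    intro n t ht
    have := (hPn (n + 1)).2.2.2.1 t ht
    rwa [hRel n t] at this
  -- geometric decay of consecutive differences
  have hDiff : ∀ n, (∀ t : ℝ, t ≤ 0 → |(xs (n + 1)).1 t - (xs n).1 t| ≤ r * κ ^ n * Real.exp (t / 2)) ∧
      (∀ t : ℝ, t < 0 → |(xs (n + 1)).2.1 t - (xs n).2.1 t| ≤ r * κ ^ n * Real.exp (t / 2)) ∧
      |(xs (n + 1)).2.2 - (xs n).2.2| ≤ r * κ ^ n := by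
    intro n
    induction n with
    | zero =>
      obtain ⟨-, -, -, -, hρ, hD, hδ⟩ := hPn 1
      refine ⟨fun t ht => ?_, fun t ht => ?_, ?_⟩
      · have : (xs 0).1 t = 0 := rfl
        rw [this, sub_zero, pow_zero, mul_one]; exact hρ t ht
      · have : (xs 0).2.1 t = 0 := rfl
        rw [this, sub_zero, pow_zero, mul_one]; exact hD t ht
      · have : (xs 0).2.2 = 0 := rfl
        rw [this, sub_zero, pow_zero, mul_one]; exact hδ
    | succ n ih =>
      obtain ⟨ih1, ih2, ih3⟩ := ih
      obtain ⟨hc₁, -, -, hd₁, hρ₁, hD₁, hδ₁⟩ := hPn (n + 1)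
      obtain ⟨hc₂, -, -, hd₂, hρ₂, hD₂, hδ₂⟩ := hPn n
      obtain ⟨hgc₁, hg0₁, hgl₁, -, hgρ₁, -, -⟩ := hPn (n + 2)
      obtain ⟨hgc₂, hg0₂, hgl₂, -, hgρ₂, -, -⟩ := hPn (n + 1)
      have hB₁ : ∀ t : ℝ, t ≤ 0 → |(xs (n + 2)).1 t| ≤ r := fun t ht =>
        (hgρ₁ t ht).trans (by
          have : Real.exp (t / 2) ≤ 1 := Real.exp_le_one_iff.2 (by linarith)
          nlinarith)
      have hB₂ : ∀ t : ℝ, t ≤ 0 → |(xs (n + 1)).1 t| ≤ r := fun t ht =>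
        (hgρ₂ t ht).trans (by
          have : Real.exp (t / 2) ≤ 1 := Real.exp_le_one_iff.2 (by linarith)
          nlinarith)
      have hC := picard_contract (μ := r * κ ^ n) hs32 hs2 hc₁ hc₂ hd₁ hd₂ hρ₁ hρ₂ hδ₁ hgc₁ hgc₂ hg0₁ hg0₂
        hgl₁ hgl₂ hB₁ hB₂ (hLaw (n + 1)) (hLaw n) ih1 ih2 ih3
      rw [hcontr] at hC
      obtain ⟨hC1, hC2, hC3⟩ := hC
      have hpow : κ * (r * κ ^ n) = r * κ ^ (n + 1) := by ring
      refine ⟨fun t ht => ?_, fun t ht => ?_, ?_⟩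
      · have := hC2 t ht; rwa [hpow] at this
      · have := hC3 t ht.le
        rw [hpow, ← hRel (n + 1) t, ← hRel n t] at this
        exact this
      · have := hC1; rwa [hpow] at this
  -- package
  refine ⟨fun n => (xs n).1, fun n => (xs n).2.1, fun n => (xs n).2.2, fun n => (hPn n).1,
    fun n => (hPn n).2.1, fun n => (hPn n).2.2.1, fun n => (hPn n).2.2.2.1, fun n => (hPn n).2.2.2.2.1,
    fun n => (hPn n).2.2.2.2.2.1, fun n => (hPn n).2.2.2.2.2.2, fun t => rfl, rfl, hRel,
    fun n => (hDiff n).1, fun n => (hDiff n).2.1, fun n => (hDiff n).2.2⟩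

end WakeRatchetRelayFixedPoint

end Summit.NavierStokesRegularity.NavierStokesRegularity.Theorems

end
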